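import Mathlib.Data.Nat.Choose.Basic
import Mathlib.Algebra.BigOperators.Intervals
import Mathlib.Algebra.Order.BigOperators.Group.Finset
import Mathlib.Tactic.Linarith
import Mathlib.Tactic.LinearCombination
import Mathlib.Tactic.Ring

/-!
# `NoHeavyLowerTail` (crux stmt-CriticalPhenomena-4575), lane prim-ineq-gen-4 (gen 18): the ARC INEQUALITY behind the half-cube
# lemma for intersecting families (Katona's circle), abstract form

Support file (`--supports stmt-CriticalPhenomena-4575`; memo `run/shared/lean/prim/prim-ineq-gen-4/PROOFS-RAB-ALL-K-g18.md` §2,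
Lemma B).  No definitions, no `sorry`, standard axioms.

On the cycle `Z_n`, `n = 2m`, the arcs of each length `j` of a down-closed family of proper arcs no two of which cover the cycle
have counts `b j` satisfying: `b j ≤ n`; `b (j+1) ≤ b j`, and `b (j+1) + 1 ≤ b j` whenever `0 < b (j+1) < n` (a set of start points
invariant under the unit rotation is empty or everything); `2·b m ≤ n` (an arc of length `m` and its antipode cover the cycle).
`arc_ineq_abstract` proves, for ANY sequence with these three properties,
   `Σ_{j=m}^{n-1} C(n,j)·b j ≤ n + Σ_{j=1}^{m-1} C(n,j)·b j`,
which, averaged over all cyclic orders, is the half-cube lemma `#{z ∈ F : #z ≥ m} ≤ #{z ∈ F : #z < m}` for down-sets `F ⊆ 𝒫([2m])`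
with no two members covering `[2m]` (companion file).  The arithmetic heart is the telescoping identity
`Σ_{l<j} C(n,l)(n − 2l) = j·C(n,j)` (`sum_choose_mul_sub_two_mul`).
-/

namespace Summit.CriticalPhenomena.PercolationContinuityZ3.Theorems.ThresholdRAB

open Finset

/-! ### Binomial arithmetic -/

/-- Telescoping: `Σ_{l<j} C(n,l)·(n − 2l) = j·C(n,j)` for `j ≤ n` (integers). [folklore] -/
theorem sum_choose_mul_sub_two_mul (n : ℕ) : ∀ j : ℕ, j ≤ n →
    ∑ l ∈ range j, ((n.choose l : ℤ) * ((n : ℤ) - 2 * l)) = (j : ℤ) * (n.choose j : ℤ) := by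
  intro j
  induction j with
  | zero => intro _; simp
  | succ j ih =>
    intro hj
    rw [sum_range_succ, ih (Nat.le_of_succ_le hj)]
    have h := Nat.choose_succ_right_eq n j
    -- `C(n,j+1) * (j+1) = C(n,j) * (n - j)` in ℕ, with `j ≤ n`
    have hjn : j ≤ n := Nat.le_of_succ_le hj
    have h' : ((n.choose (j + 1) : ℤ)) * ((j : ℤ) + 1) = (n.choose j : ℤ) * ((n : ℤ) - j) := by
      have := congrArg (fun x : ℕ => (x : ℤ)) h
      push_cast [Nat.cast_sub hjn] at this
      linarith
    push_cast
    linear_combination -1 * h'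

/-- Partial telescoping over an interval: `Σ_{u ≤ l < m} C(n,l)(n − 2l) = m·C(n,m) − u·C(n,u)` (`u ≤ m ≤ n`). [folklore] -/
theorem sum_Ico_choose_mul_sub_two_mul (n u m : ℕ) (hum : u ≤ m) (hmn : m ≤ n) :
    ∑ l ∈ Ico u m, ((n.choose l : ℤ) * ((n : ℤ) - 2 * l))
      = (m : ℤ) * (n.choose m : ℤ) - (u : ℤ) * (n.choose u : ℤ) := by
  have h1 := sum_choose_mul_sub_two_mul n m hmn
  have h2 := sum_choose_mul_sub_two_mul n u (hum.trans hmn)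
  have h3 := sum_range_add_sum_Ico (fun l => ((n.choose l : ℤ) * ((n : ℤ) - 2 * l))) hum
  linarith

/-- The arithmetic inequality `A(m,u)`: for `n = 2m`, `u ≤ m − 1`,
`(m − u)·C(n,m) + Σ_{1 ≤ l < m} C(n,l)·(l − u)⁺ ≤ n + Σ_{1 ≤ l < m} C(n,l)·(n − u − l)`. [this work] -/
theorem arith_A (m u : ℕ) (hu : u + 1 ≤ m) :
    ((m : ℤ) - u) * ((2 * m).choose m : ℤ) + ∑ l ∈ Ico 1 m, ((2 * m).choose l : ℤ) * (max ((l : ℤ) - u) 0)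
      ≤ 2 * (m : ℤ) + ∑ l ∈ Ico 1 m, ((2 * m).choose l : ℤ) * (2 * (m : ℤ) - u - l) := by
  set n := 2 * m with hn
  -- pointwise: C(n,l)(n-u-l) - C(n,l)(l-u)⁺ ≥ [u ≤ l]·C(n,l)(n-2l)
  have hpt : ∀ l ∈ Ico 1 m,
      (if u ≤ l then ((n.choose l : ℤ) * ((n : ℤ) - 2 * l)) else 0)
        ≤ (n.choose l : ℤ) * (2 * (m : ℤ) - u - l) - (n.choose l : ℤ) * (max ((l : ℤ) - u) 0) := by
    intro l hl
    rw [mem_Ico] at hl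
    have hc : (0 : ℤ) ≤ (n.choose l : ℤ) := by exact_mod_cast Nat.zero_le _
    by_cases hul : u ≤ l
    · rw [if_pos hul, max_eq_left (by omega : (0:ℤ) ≤ (l:ℤ) - u)]
      push_cast [hn]
      nlinarith
    · rw [if_neg hul, max_eq_right (by omega : (l:ℤ) - u ≤ 0)]
      have : (0 : ℤ) ≤ 2 * (m : ℤ) - u - l := by omega
      nlinarith
  have hsum := sum_le_sum hpt
  rw [sum_sub_distrib, ← sum_filter] at hsum
  -- the filtered telescoping sum: l ∈ Ico 1 m with u ≤ l  =  Ico (max u 1) m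
  have hfilt : (Ico 1 m).filter (fun l => u ≤ l) = Ico (max u 1) m := by
    ext l; simp only [mem_filter, mem_Ico]; omega
  rw [hfilt, sum_Ico_choose_mul_sub_two_mul n (max u 1) m (by omega) (by omega)] at hsum
  -- `max u 1 * C(n, max u 1) ≤ u * C(n,m) + n` : if u = 0 it is `C(n,1) = n`, else `u C(n,u) ≤ u C(n,m)`
  have hmid : ((max u 1 : ℕ) : ℤ) * (n.choose (max u 1) : ℤ) ≤ (u : ℤ) * (n.choose m : ℤ) + n := by
    rcases Nat.eq_zero_or_pos u with rfl | hu0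
    · simp [hn]
    · rw [max_eq_left hu0]
      have h1 : n.choose u ≤ n.choose m := by
        have := Nat.choose_le_middle u (2 * m)
        rwa [Nat.mul_div_cancel_left m (by norm_num : 0 < 2)] at this
      have h2 : (n.choose u : ℤ) ≤ (n.choose m : ℤ) := by exact_mod_cast h1
      have h3 : (0 : ℤ) ≤ n := by positivity
      nlinarith
  push_cast [hn] at hsum hmid ⊢
  nlinarith [hsum, hmid]

/-! ### The abstract arc inequality -/

/-- Downward growth iterated: if `b` is non-increasing with unit drops while in `(0,n)`, then from `b j₀ = t ≥ 1`
one gets `b (j₀ - i) ≥ min (t + i) n`. Stated upward: `b l ≥ min (b (l + i) + i) n` when `b (l+i) ≥ 1`. [this work] -/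
theorem growth_down (n : ℕ) (b : ℕ → ℕ)
    (hmono : ∀ j, 1 ≤ j → j + 2 ≤ n → b (j + 1) ≤ b j)
    (hstep : ∀ j, 1 ≤ j → j + 2 ≤ n → 0 < b (j + 1) → b (j + 1) < n → b (j + 1) + 1 ≤ b j) :
    ∀ i l, 1 ≤ l → l + i + 1 ≤ n → 0 < b (l + i) → min (b (l + i) + i) n ≤ b l := by
  intro i
  induction i with
  | zero => intro l _ _ _; simp
  | succ i ih =>
    intro l hl hli hpos
    have e : l + (i + 1) = l + 1 + i := by omega
    rw [e] at hpos hli ⊢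
    -- i steps from l+1+i down to l+1, then one step from l+1 to l
    have h1 := ih (l + 1) (by omega) (by omega) hpos
    have hn : 0 < n := by omega
    have hpos1 : 0 < b (l + 1) := lt_of_lt_of_le (by omega : 0 < min (b (l + 1 + i) + i) n) h1
    by_cases hlt : b (l + 1) < n
    · have h2 := hstep l hl (by omega) hpos1 hlt
      omega
    · have h2 := hmono l hl (by omega)
      omega

/-- **Abstract arc inequality** (memo Lemma B).  Let `n = 2m ≥ 2` and `b : ℕ → ℕ` satisfy, for the indices `1 ≤ j ≤ n − 1`:
`b (j+1) ≤ b j` and `0 < b (j+1) < n → b (j+1) + 1 ≤ b j`; and `2·b m ≤ n` (the bound `b j ≤ n` is not even needed).  Then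
`Σ_{m ≤ j < n} C(n,j)·b j ≤ n + Σ_{1 ≤ j < m} C(n,j)·b j`. [this work] -/
theorem arc_ineq_abstract (m : ℕ) (hm : 1 ≤ m) (b : ℕ → ℕ)
    (hmono : ∀ j, 1 ≤ j → j + 2 ≤ 2 * m → b (j + 1) ≤ b j)
    (hstep : ∀ j, 1 ≤ j → j + 2 ≤ 2 * m → 0 < b (j + 1) → b (j + 1) < 2 * m → b (j + 1) + 1 ≤ b j)
    (hmid : 2 * b m ≤ 2 * m) :
    ∑ j ∈ Ico m (2 * m), (((2 * m).choose j : ℤ) * (b j : ℤ))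
      ≤ 2 * (m : ℤ) + ∑ j ∈ Ico 1 m, (((2 * m).choose j : ℤ) * (b j : ℤ)) := by
  set n := 2 * m with hn
  set t := b m with ht
  have htm : t ≤ m := by omega
  -- monotonicity iterated: b j ≤ b m for m ≤ j ≤ n - 1
  have hmono' : ∀ i j, 1 ≤ j → j + i + 1 ≤ n → b (j + i) ≤ b j := by
    intro i
    induction i with
    | zero => intro j _ _; simp
    | succ i ih =>
      intro j hj hji
      have e : j + (i + 1) = j + 1 + i := by omega
      rw [e] at hji ⊢
      exact (ih (j + 1) (by omega) hji).trans (hmono j hj (by omega))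
  by_cases ht0 : t = 0
  · -- all upper levels vanish
    have hzero : ∀ j ∈ Ico m n, (((n.choose j : ℤ)) * (b j : ℤ)) = 0 := by
      intro j hj
      rw [mem_Ico] at hj
      have := hmono' (j - m) m hm (by omega)
      rw [show m + (j - m) = j by omega] at this
      have hbj : b j = 0 := by omega
      simp [hbj]
    rw [sum_congr rfl hzero, sum_const_zero]
    have : (0 : ℤ) ≤ ∑ j ∈ Ico 1 m, ((n.choose j : ℤ) * (b j : ℤ)) :=
      sum_nonneg fun j _ => by positivity
    push_cast [hn] at this ⊢
    linarith
  have ht1 : 1 ≤ t := Nat.one_le_iff_ne_zero.2 ht0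
  set u := m - t with hu
  have hum : u + 1 ≤ m := by omega
  -- LOWER levels: b l ≥ t + m - l = n - u - l for 1 ≤ l < m
  have hlow : ∀ l ∈ Ico 1 m, ((n.choose l : ℤ)) * (2 * (m : ℤ) - u - l) ≤ (n.choose l : ℤ) * (b l : ℤ) := by
    intro l hl
    rw [mem_Ico] at hl
    have hg := growth_down n b hmono hstep (m - l) l hl.1 (by omega) (by rw [show l + (m - l) = m by omega]; omega)
    rw [show l + (m - l) = m by omega] at hg
    have hbl : t + (m - l) ≤ b l := by
      have : min (t + (m - l)) n ≤ b l := hg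
      have : t + (m - l) ≤ n := by omega
      omega
    have hc : (0 : ℤ) ≤ (n.choose l : ℤ) := by positivity
    have : (2 * (m : ℤ) - u - l) ≤ (b l : ℤ) := by omega
    nlinarith
  -- UPPER levels j = n - l, 1 ≤ l < m: b j ≤ (l - u)⁺, i.e. b j ≤ max (t + m - j) 0
  have hupp : ∀ j ∈ Ico (m + 1) n, ((n.choose j : ℤ)) * (b j : ℤ)
      ≤ (n.choose j : ℤ) * (max ((((n - j : ℕ) : ℤ)) - u) 0) := by
    intro j hj
    rw [mem_Ico] at hj
    have hc : (0 : ℤ) ≤ (n.choose j : ℤ) := by positivity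
    have hbj : (b j : ℤ) ≤ max ((((n - j : ℕ) : ℤ)) - u) 0 := by
      by_cases hpos : 0 < b j
      · have hg := growth_down n b hmono hstep (j - m) m hm (by omega) (by rw [show m + (j - m) = j by omega]; exact hpos)
        rw [show m + (j - m) = j by omega] at hg
        have : b j + (j - m) ≤ t := by
          have h1 : min (b j + (j - m)) n ≤ t := hg
          have : t < n := by omega
          omega
        have h' : (b j : ℤ) ≤ ((n - j : ℕ) : ℤ) - u := by omega
        exact h'.trans (le_max_left _ _)
      · have : b j = 0 := by omega
        simp [this]
    nlinarith
  -- assemble: split the upper sum at m, reindex j = n - l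
  have hsplit : ∑ j ∈ Ico m n, ((n.choose j : ℤ) * (b j : ℤ))
      = (n.choose m : ℤ) * t + ∑ j ∈ Ico (m + 1) n, ((n.choose j : ℤ) * (b j : ℤ)) := by
    rw [← sum_Ico_consecutive _ (Nat.le_succ m) (by omega : m + 1 ≤ n), Nat.Ico_succ_singleton, sum_singleton]
  have hreindex : ∑ j ∈ Ico (m + 1) n, ((n.choose j : ℤ) * (max ((((n - j : ℕ) : ℤ)) - u) 0))
      = ∑ l ∈ Ico 1 m, ((n.choose l : ℤ) * (max ((l : ℤ) - u) 0)) := by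
    refine sum_bij (fun j _ => n - j) (fun j hj => ?_) (fun j hj j' hj' h => ?_) (fun l hl => ?_) (fun j hj => ?_)
    · rw [mem_Ico] at hj ⊢; omega
    · rw [mem_Ico] at hj hj'; omega
    · rw [mem_Ico] at hl
      exact ⟨n - l, by rw [mem_Ico]; omega, by omega⟩
    · rw [mem_Ico] at hj
      rw [Nat.choose_symm (by omega : j ≤ n)]
  have hA := arith_A m u hum
  have h1 : ∑ j ∈ Ico (m + 1) n, ((n.choose j : ℤ) * (b j : ℤ))
      ≤ ∑ l ∈ Ico 1 m, ((n.choose l : ℤ) * (max ((l : ℤ) - u) 0)) := by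
    rw [← hreindex]; exact sum_le_sum hupp
  have h2 : ∑ l ∈ Ico 1 m, ((n.choose l : ℤ)) * (2 * (m : ℤ) - u - l)
      ≤ ∑ j ∈ Ico 1 m, ((n.choose j : ℤ) * (b j : ℤ)) := sum_le_sum hlow
  have htu : (t : ℤ) = (m : ℤ) - u := by omega
  rw [hsplit, htu]
  push_cast [hn] at h1 h2 hA ⊢
  linarith

end Summit.CriticalPhenomena.PercolationContinuityZ3.Theorems.ThresholdRAB
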